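import Literature.MathematicalPhysics.QuantumFieldTheory.Balaban1983to89.B7Prop2Explicit

/-!
# `Balaban1983to89.B7Eq47AveragedBondVsStraight` — T. Bałaban, *Averaging operations for lattice gauge theories*, Commun. Math. Phys. **98** (1985)
# 17–51 [Balaban1985Averaging] (42)–(43) pp. 23–24, the displays before (47) p. 25 and (52)–(54) p. 26: **THE `j`-FOLD AVERAGED BOND VARIABLE IS
# WITHIN `O(1)·α₀·(L^jη)²` OF THE STRAIGHT FINE TRANSPORTER**, `‖Ū^j(c) − U(c)‖ ≤ 256(d+1)(d+4)·α₀·(L^j∕L^k)²` for `U` with `|U(∂p) − 1| < α₀η²`,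
# `η = L^{−k}` — UNIFORMLY IN THE NUMBER OF LEVELS (the «non-abelian Stokes count» for the averaged bonds: area `(L^jη)²`, not `(O(1)L)^j`)

statement-level skeleton of published theorems with citation tags; proofs where landed; nothing here is a claim about the Yang–Mills mass gap

CITATION HEADER (lean-in-tree rule).  Audit cell `pub-balaban`, sub-cell `t4`, BINDER row NE9; filed by NE9 formalisation-swarm leaf prover 03
(`b2b-balaban-t4-ne9-formalise-leaf-03`, gen 64) as the FIRST BRICK of the k-LEVEL «TIER P» programme located by this lineage (gen 63, journal
l.47483: «the k-step (tower) Tier P needs an AREA count (non-abelian Stokes for the AVERAGED bonds …), not the `(8(d+1)L)^j·ε` telescoping of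
`B7Eq43AveragedSmallness`»).  Source READ in the held text: [Balaban1985Averaging] pp. 23–26 (`paper:balaban1985-cmp98-averaging`, journal page =
PDF page + 16), quoted verbatim in the headers of `B7Prop1Explicit` ∕ `B7Prop2Explicit` (lit-balaban cell, paper sub-cell B07), whose objects
(`hol`, `seg`, `Wcx`, `Xavg`, `bavg`, `avgIter`, `pdev`, `U1`, `AvgClosed`, `C0`, `c2'`) this file uses BY NAME; nothing re-declared.

THE PRINT (verbatim).  (42) p. 23: *«Ū_c = exp[i Σ_{x∈B(c₋)} L^{−d} (1∕i) log U(Γ_{c,x}) U(c)⁻¹] U(c), c ⊂ Ω^{(1)}»* — so `Ū_c·U(c)⁻¹ = exp[X_c]`;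
(9) p. 18: *«This definition [U(Γ) = Π U(x_i, x_{i+1})] will be applied also to contours on arbitrary lattices»* — `U(c)` for a coarse bond `c` is
the transporter along the STRAIGHT fine contour; p. 25 (before (47)): *«|V₀(Γ_{c,x}) − 1| < |Γ_{c,x}| dLα₀ < (2d+1)L dLα₀ = O(1)L²α₀ … these
inequalities hold for arbitrary c ∈ B′(y)»*; (52)–(54) p. 26: *«we have to assume that |U(∂p) − 1| < α₀η², η = L^{−k} (52) … |Ū^j(∂p) − 1| <
α₀L^{2j}η² + C₀(α₀L^{2j}η²)²·[1 + L^{−2}(1+C₀α₀)² + …] (53) … The right-hand side can be bounded by α₀ + C₀α₀²2 … < 2α₀»*.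

WHAT IS PROVED (sorry-free; proof lane — 0 `def`, no `Prop` placeholder; [folklore] algebra on the lit-balaban cell's certified (42)–(43), (51)–(54)).
* §1 **`norm_bavg_sub_straight_le`** — ONE STEP, LETTER FORM: if every loop variable `V(Γ_{c,x})V(c)⁻¹` of the coarse bond `c = ⟨q, q + Le_κ⟩` is
  within `w ≤ 1∕8` of `1` and `V` is unit-bounded, then `‖V̄(c) − V(c)‖ ≤ 4w` (`V̄(c) − V(c) = (e^{X_c} − 1)V(c)`, `‖X_c‖ ≤ 2w`);
  **`norm_bavg_sub_straight_le_of_pdev`** — under (44) `|V(∂p) − 1| ≤ α₀` with `512(d+1)(d+4)L²α₀ ≤ 1`: `‖V̄(c) − V(c)‖ ≤ 64(d+1)(d+4)L²α₀`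
  (`B7Prop2Explicit.norm_Wcx_sub_one_le`: the loop encloses `O(L²)` plaquettes — the AREA count).
* §2 `hol_seg_mul_add`, **`norm_hol_seg_sub_hol_seg_le`** — products along a segment: if each of `n` consecutive unit-bounded coarse bond variables
  is within `E` of the fine transporter along the corresponding sub-segment of `N` fine bonds, the transporter along the `n` coarse bonds is within
  `n·E` of the fine transporter along the `nN` fine bonds (telescoping in the unit ball).
* §3 **`pdev_avgIter_lt_two_mul`** — (53)∕(54) AT EVERY LEVEL `j ≤ k` for an averaging-closed subgroup: `pdev(Ū^j) < 2α₀(L^j∕L^k)²`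
  (`B7Prop2Explicit.ineq53_explicit` + `B7.prop2_ratio_lt_half` + `B7.geom_bracket_le_two`; the lit-balaban `B7Eq50Linear.pdev_avgIter_lt_level` is the
  `AvgClosedAt` sibling); **`norm_avgIter_sub_straight_le`** — THE TOWER: for `j ≤ k`, every site `z` and direction `κ` of the level-`j` lattice,
  `‖Ū^j(z, κ) − U(L^j z; seg_κ(L^j))‖ ≤ 256(d+1)(d+4)·α₀·(L^j∕L^k)²` — induction on (43): `E_{j+1} ≤ L·E_j + 64(d+1)(d+4)L²·2α₀(L^j∕L^k)²`, closed by
  `128L² + 256L ≤ 256L²` (`2 ≤ L`); at the top level `‖Ū^k(c) − U(c)‖ ≤ 256(d+1)(d+4)α₀`.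
WHY (cell context).  The NE9 chain's k-level files (`B9Eq315QTowerLipschitz*`, `B9Eq319QprimeTowerLipschitzL2`, `B9Thm311SmallFieldCoercivityTower*`,
`B9Eq325RLipschitzSqrtTowerDiagonal`, `B9Thm311SitePrimeFormCoerciveTowerCanonical`) DISPLAY the per-level bond smallness `‖Ū^j(b) − 1‖ ≤ ε_j` with a
geometric profile; `B7Eq43AveragedSmallness` reads it off `‖U(b) − 1‖ ≤ ε` with the constant `(8(d+1)L)^j` — exponential in the number of levels.
This file is the level-free half of the cure: the averaged bond differs from the straight fine transporter by the AREA `α₀(L^jη)²`; in a block axial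
gauge the straight transporter of length `L^jη` is `O(α₀·L^jη)`-close to `1` (the LENGTH count, `B7Eq44TorusAxialGaugeLocal`), so `ε_j = O(α₀L^jη)` —
the profile print's (3.37) ∕ Lemma 3.1 of [Balaban1985BackgroundPropagators] provides, from the gauge-invariant class (52) alone (next files).
HONEST SCOPE.  [folklore] composition of the lit-balaban cell's kernel-certified Propositions 1–2 with the exponential series bound; the class is
print's (52) on ALL of `ℤ^d` (periodic extensions of torus configurations qualify); the gauge-dependent LENGTH count and the torus ∕ block bookkeeping
are NOT here.  NOT summit progress (cell pub-balaban: NE9 NOT PRINTED ∕ NOT PROVED; «NE9 ⇐ the named binders»; spine PROVED 0/9; rung (B)+1 finite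
T⁴ — NOT infinite volume, NOT mass gap, NOT Clay; HONEST DEPENDENCY: continuum YM on T⁴ ⇐ BetaPertH ∧ nine spine estimates (0/9 proved); BetaPertH ⇐
(D1) ∧ (D4) ∧ CAP+tail; G-an2-4 gates asym, D1 and NE2/3/4).  NEW file; nothing modified.  Net new unproved facts: 0.
-/

noncomputable section

open scoped BigOperators
open NormedSpace Finset

namespace Literature.MathematicalPhysics.QuantumFieldTheory.Balaban1983to89.B7Eq47AveragedBondVsStraight

open B7Prop1Explicit MatrixLog
open B7Prop2Explicit (pdev le_pdev pdev_nonneg avgIter avgIter_zero avgIter_succ rescale_apply C0 c2' C0_pos AvgClosed avgIter_mem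
  ineq53_explicit norm_Wcx_sub_one_le)

variable {d : ℕ}

/-! ## §1 One averaging step: `V̄(c) − V(c) = (e^{X_c} − 1)·V(c)` -/

section OneStep

variable {𝔸 : Type*} [NormedRing 𝔸] [NormOneClass 𝔸] [NormedAlgebra ℂ 𝔸] [CompleteSpace 𝔸] (L : ℕ)

omit [NormOneClass 𝔸] in
/-- the exponent of (42) is small when the loop variables are: `‖X_c‖ ≤ 2w` if every `‖V(Γ_{c,x})V(c)⁻¹ − 1‖ ≤ w ≤ 1∕2` (`‖log u‖ ≤ 2‖u − 1‖`,
(26) p. 22, averaged over the `L^d` sites of `B(c₋)`). [cite: Balaban1985Averaging, (42) p.23, (26)–(27) p.22] -/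
private theorem norm_Xavg_le {V : B7Prop1Explicit.Site d → Fin d → 𝔸ˣ} (q : B7Prop1Explicit.Site d) (κ : Fin d) {w : ℝ}
    (hw : ∀ r : Fin d → Fin L, ‖((Wcx L V q κ (boxVec L r) : 𝔸ˣ) : 𝔸) - 1‖ ≤ w) (hw2 : w ≤ 1 / 2) [NeZero L] :
    ‖Xavg L V q κ‖ ≤ 2 * w := by
  unfold Xavg
  refine (norm_sum_le _ _).trans ?_
  have hcard : (Finset.univ : Finset (Fin d → Fin L)).card = L ^ d := by simp
  have hLd : (0 : ℝ) < (L : ℝ) ^ d := pow_pos (by exact_mod_cast Nat.pos_of_ne_zero (NeZero.ne L)) d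
  calc ∑ r : Fin d → Fin L, ‖(((L : ℝ) ^ d)⁻¹) • mlog ((Wcx L V q κ (boxVec L r) : 𝔸ˣ) : 𝔸)‖
      ≤ ∑ _r : Fin d → Fin L, ((L : ℝ) ^ d)⁻¹ * (2 * w) := Finset.sum_le_sum fun r _ => by
        rw [norm_smul, norm_inv, norm_pow, Real.norm_natCast]
        exact mul_le_mul_of_nonneg_left ((norm_mlog_le_two_mul ((hw r).trans hw2)).trans (by linarith [hw r])) (by positivity)
    _ = 2 * w := by rw [Finset.sum_const, hcard, nsmul_eq_mul]; push_cast; field_simp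

/-- **ONE STEP, LETTER FORM: `‖V̄(c) − V(c)‖ ≤ 4w`** for a unit-bounded `V` whose loop variables `V(Γ_{c,x})V(c)⁻¹`, `x ∈ B(c₋)`, are within
`w ≤ 1∕8` of `1` — `V̄(c) = e^{X_c}V(c)` ((42)), `‖X_c‖ ≤ 2w`, `‖e^{X} − 1‖ ≤ e^{‖X‖} − 1 ≤ 4w`, `‖V(c)‖ ≤ 1`.  `V(c)` = the transporter along the
STRAIGHT contour `Γ_c` of `L` fine bonds ((9) «applied also to contours on arbitrary lattices»). [cite: Balaban1985Averaging, (42) p.23, (9) p.18, p.25] -/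
theorem norm_bavg_sub_straight_le [NeZero L] {V : B7Prop1Explicit.Site d → Fin d → 𝔸ˣ} (hV : ∀ x κ, V x κ ∈ U1 𝔸) (q : B7Prop1Explicit.Site d) (κ : Fin d) {w : ℝ}
    (hw : ∀ r : Fin d → Fin L, ‖((Wcx L V q κ (boxVec L r) : 𝔸ˣ) : 𝔸) - 1‖ ≤ w) (hw8 : w ≤ 1 / 8) :
    ‖((bavg L V q κ : 𝔸ˣ) : 𝔸) - ((hol V q (seg κ (L : ℤ)) : 𝔸ˣ) : 𝔸)‖ ≤ 4 * w := by
  have hw0 : 0 ≤ w := (norm_nonneg _).trans (hw fun _ => 0)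
  have hX : ‖Xavg L V q κ‖ ≤ 2 * w := norm_Xavg_le L q κ hw (by linarith)
  have hE : ‖exp (Xavg L V q κ) - 1‖ ≤ 4 * w := by
    refine (norm_exp_sub_one_le_of_norm_le hX).1.trans ?_
    have h := Real.abs_exp_sub_one_le (x := 2 * w) (by rw [abs_of_nonneg (by linarith)]; linarith)
    rw [abs_of_nonneg (by linarith : (0 : ℝ) ≤ 2 * w)] at h
    linarith [le_abs_self (Real.exp (2 * w) - 1)]
  have hS : ‖((hol V q (seg κ (L : ℤ)) : 𝔸ˣ) : 𝔸)‖ ≤ 1 := (mem_U1.1 (hol_mem hV q _)).1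
  have e : ((bavg L V q κ : 𝔸ˣ) : 𝔸) - ((hol V q (seg κ (L : ℤ)) : 𝔸ˣ) : 𝔸) =
      (exp (Xavg L V q κ) - 1) * ((hol V q (seg κ (L : ℤ)) : 𝔸ˣ) : 𝔸) := by
    rw [sub_mul, one_mul]; rfl
  rw [e]
  exact (norm_mul_le _ _).trans (by nlinarith [norm_nonneg (exp (Xavg L V q κ) - 1)])

/-- **ONE STEP UNDER (44): `‖V̄(c) − V(c)‖ ≤ 64(d+1)(d+4)L²·α₀`** for a unit-bounded `V` with `|V(∂p) − 1| ≤ α₀` on `ℤ^d` and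
`512(d+1)(d+4)L²α₀ ≤ 1` — the loop variables are within `2θ`, `θ = 8(d+1)(d+4)L²α₀`, of `1` (`B7Prop2Explicit.norm_Wcx_sub_one_le`: the loop
`Γ_{c,x} ∪ (−Γ_c)` bounds `O(L²)` plaquettes — THE AREA COUNT of p. 25). [cite: Balaban1985Averaging, (42) p.23, (44) p.24, p.25] -/
theorem norm_bavg_sub_straight_le_of_pdev (hL : 1 ≤ L) {V : B7Prop1Explicit.Site d → Fin d → 𝔸ˣ} (hV : ∀ x κ, V x κ ∈ U1 𝔸) {α₀ : ℝ} (hα₀ : 0 ≤ α₀)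
    (hsmall : 512 * (d + 1) * (d + 4) * (L : ℝ) ^ 2 * α₀ ≤ 1)
    (h44 : ∀ (x : B7Prop1Explicit.Site d) (κ κ' : Fin d), κ ≠ κ' → ‖((hol V x (plaqWord κ κ') : 𝔸ˣ) : 𝔸) - 1‖ ≤ α₀) (q : B7Prop1Explicit.Site d) (κ : Fin d) :
    ‖((bavg L V q κ : 𝔸ˣ) : 𝔸) - ((hol V q (seg κ (L : ℤ)) : 𝔸ˣ) : 𝔸)‖ ≤ 64 * (d + 1) * (d + 4) * (L : ℝ) ^ 2 * α₀ := by
  haveI : NeZero L := ⟨by omega⟩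
  have hw := norm_Wcx_sub_one_le L hL V hV hα₀ hsmall h44 q κ
  have h8 : 2 * (8 * (d + 1) * (d + 4) * (L : ℝ) ^ 2 * α₀) ≤ 1 / 8 := by
    have : (0 : ℝ) ≤ (d + 1) * (d + 4) * (L : ℝ) ^ 2 * α₀ := by positivity
    nlinarith
  exact (norm_bavg_sub_straight_le L hV q κ hw h8).trans (le_of_eq (by ring))

end OneStep

/-! ## §2 Transporters along segments: `n` coarse bonds against `nN` fine bonds -/

section Segments

variable {𝔸 : Type*} [NormedRing 𝔸] [NormOneClass 𝔸]

omit [NormOneClass 𝔸] in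
/-- `V(seg_κ(a + b)) = V(seg_κ a)·V(seg_κ b)` from the shifted base point ((9): `U(Γ₁ ∪ Γ₂) = U(Γ₁)U(Γ₂)`). [cite: Balaban1985Averaging, (9) p.18] -/
theorem hol_seg_mul_add (V : B7Prop1Explicit.Site d → Fin d → 𝔸ˣ) (x : B7Prop1Explicit.Site d) (κ : Fin d) (a b : ℕ) :
    hol V x (seg κ ((a + b : ℕ) : ℤ)) = hol V x (seg κ (a : ℤ)) * hol V (x + (a : ℤ) • e κ) (seg κ (b : ℤ)) := by
  rw [seg_natCast, seg_natCast, seg_natCast, List.replicate_add, hol_append, disp_replicate, Letter.vec_true]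

omit [NormOneClass 𝔸] in
/-- telescoping in the unit ball: `‖Pa − Qb‖ ≤ ‖P − Q‖ + ‖a − b‖` for `‖P‖ ≤ 1`, `‖b‖ ≤ 1`. [folklore] -/
private theorem norm_mul_sub_mul_le' {P Q a b : 𝔸} (hP : ‖P‖ ≤ 1) (hb : ‖b‖ ≤ 1) : ‖P * a - Q * b‖ ≤ ‖P - Q‖ + ‖a - b‖ := by
  have e : P * a - Q * b = P * (a - b) + (P - Q) * b := by noncomm_ring
  rw [e]
  refine (norm_add_le _ _).trans ?_
  have h1 := (norm_mul_le P (a - b)).trans (mul_le_of_le_one_left (norm_nonneg _) hP)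
  have h2 := (norm_mul_le (P - Q) b).trans (mul_le_of_le_one_right (norm_nonneg _) hb)
  linarith

/-- **`n` COARSE BONDS AGAINST `nN` FINE BONDS**: for unit-bounded `W` (coarse) and `V` (fine), if for `i < n` the coarse bond variable
`W(x + ie_κ, κ)` is within `E` of the fine transporter `V(y + iNe_κ; seg_κ N)`, then `‖W(x; seg_κ n) − V(y; seg_κ(nN))‖ ≤ n·E` — the transporters
along `Γ₁ ∪ Γ₂` multiply ((9)), every factor has norm `≤ 1`. [cite: Balaban1985Averaging, (9) p.18, (43) p.24] -/
theorem norm_hol_seg_sub_hol_seg_le {W V : B7Prop1Explicit.Site d → Fin d → 𝔸ˣ} (hW : ∀ x κ, W x κ ∈ U1 𝔸) (hV : ∀ x κ, V x κ ∈ U1 𝔸) (N : ℕ)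
    (x y : B7Prop1Explicit.Site d) (κ : Fin d) {E : ℝ} (hE : 0 ≤ E) :
    ∀ n : ℕ, (∀ i : ℕ, i < n → ‖((W (x + (i : ℤ) • e κ) κ : 𝔸ˣ) : 𝔸) - ((hol V (y + ((i * N : ℕ) : ℤ) • e κ) (seg κ (N : ℤ)) : 𝔸ˣ) : 𝔸)‖ ≤ E) →
      ‖((hol W x (seg κ (n : ℤ)) : 𝔸ˣ) : 𝔸) - ((hol V y (seg κ ((n * N : ℕ) : ℤ)) : 𝔸ˣ) : 𝔸)‖ ≤ n * E
  | 0, _ => by simp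
  | n + 1, h => by
    have ih := norm_hol_seg_sub_hol_seg_le hW hV N x y κ hE n fun i hi => h i (Nat.lt_succ_of_lt hi)
    have hlast := h n (Nat.lt_succ_self n)
    rw [show ((n + 1 : ℕ) : ℤ) = (n : ℤ) + 1 by push_cast; rfl, hol_seg_succ, Nat.succ_mul, hol_seg_mul_add, Units.val_mul, Units.val_mul]
    have hP : ‖((hol W x (seg κ (n : ℤ)) : 𝔸ˣ) : 𝔸)‖ ≤ 1 := (mem_U1.1 (hol_mem hW x _)).1
    have hb : ‖((hol V (y + ((n * N : ℕ) : ℤ) • e κ) (seg κ (N : ℤ)) : 𝔸ˣ) : 𝔸)‖ ≤ 1 := (mem_U1.1 (hol_mem hV _ _)).1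
    calc _ ≤ ‖((hol W x (seg κ (n : ℤ)) : 𝔸ˣ) : 𝔸) - ((hol V y (seg κ ((n * N : ℕ) : ℤ)) : 𝔸ˣ) : 𝔸)‖ +
          ‖((W (x + (n : ℤ) • e κ) κ : 𝔸ˣ) : 𝔸) - ((hol V (y + ((n * N : ℕ) : ℤ) • e κ) (seg κ (N : ℤ)) : 𝔸ˣ) : 𝔸)‖ :=
          norm_mul_sub_mul_le' hP hb
      _ ≤ n * E + E := add_le_add ih hlast
      _ = (n + 1 : ℕ) * E := by push_cast; ring

end Segments

/-! ## §3 The tower: `‖Ū^j(c) − U(c)‖ ≤ 256(d+1)(d+4)·α₀·(L^j∕L^k)²` -/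

section Tower

variable {𝔸 : Type*} [NormedRing 𝔸] [NormOneClass 𝔸] [NormedAlgebra ℂ 𝔸] [CompleteSpace 𝔸] (L : ℕ) (hL : 2 ≤ L)
  {G : Subgroup 𝔸ˣ} (hG : AvgClosed d L G) (k : ℕ) (V : B7Prop1Explicit.Site d → Fin d → 𝔸ˣ) (hV : ∀ x κ, V x κ ∈ G) {α₀ : ℝ} (hα : 0 < α₀)
  (hα3 : C0 d * α₀ ≤ 1 / 3) (hα2 : 2 * α₀ ≤ c2' d L) (h52 : pdev V < α₀ * (((L : ℝ) ^ k)⁻¹) ^ 2)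

include hL hG hV hα hα3 hα2 h52 in
/-- **(53)∕(54) AT EVERY LEVEL: `pdev(Ū^j) < 2α₀(L^j∕L^k)²` for `j ≤ k`** — `ineq53_explicit`'s bracket is `≤ 2` (`L^{−2}(1 + C₀α₀)² < ½`,
`B7.prop2_ratio_lt_half`, `B7.geom_bracket_le_two`) and `a_j := α₀(L^j∕L^k)² ≤ α₀`, `C₀α₀ ≤ ⅓` give `a_j + 2C₀a_j² ≤ (5∕3)a_j < 2a_j`.
[cite: Balaban1985Averaging, Prop. 2 (52)–(54) p.26] -/
theorem pdev_avgIter_lt_two_mul (j : ℕ) (hj : j ≤ k) :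
    pdev (avgIter L V j) < 2 * (α₀ * ((L : ℝ) ^ j * ((L : ℝ) ^ k)⁻¹) ^ 2) := by
  have hLr : (2 : ℝ) ≤ L := by exact_mod_cast hL
  have hL0 : (0 : ℝ) < L := by linarith
  have h53 := ineq53_explicit L hL hG k V hV hα hα3 hα2 h52 j hj
  have hC := C0_pos d
  have hCα : 0 ≤ C0 d * α₀ := by positivity
  have hρ := B7.prop2_ratio_lt_half (C0 d) α₀ (L : ℝ) hLr hCα hα3
  have hbr := B7.geom_bracket_le_two ((1 + C0 d * α₀) ^ 2 / (L : ℝ) ^ 2) (by positivity) hρ.le j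
  set a : ℝ := α₀ * ((L : ℝ) ^ j * ((L : ℝ) ^ k)⁻¹) ^ 2 with ha
  have ha0 : 0 < a := by rw [ha]; positivity
  -- `a ≤ α₀` since `j ≤ k`
  have hratio : (L : ℝ) ^ j * ((L : ℝ) ^ k)⁻¹ ≤ 1 := by
    rw [← div_eq_mul_inv, div_le_one (by positivity)]
    exact pow_le_pow_right₀ (by linarith) hj
  have haα : a ≤ α₀ := by
    rw [ha]
    have : ((L : ℝ) ^ j * ((L : ℝ) ^ k)⁻¹) ^ 2 ≤ 1 := by
      have h0 : 0 ≤ (L : ℝ) ^ j * ((L : ℝ) ^ k)⁻¹ := by positivity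
      nlinarith
    nlinarith
  have h2 : C0 d * a ^ 2 * ∑ i ∈ Finset.range j, ((1 + C0 d * α₀) ^ 2 / (L : ℝ) ^ 2) ^ i ≤ 2 * C0 d * a ^ 2 := by
    have := mul_le_mul_of_nonneg_left hbr (by positivity : 0 ≤ C0 d * a ^ 2)
    linarith
  have h3 : 2 * C0 d * a ^ 2 < a := by
    have : C0 d * a ≤ 1 / 3 := (mul_le_mul_of_nonneg_left haα hC.le).trans hα3
    nlinarith
  linarith [h53, h2, h3]

include hL hG hV hα hα3 hα2 h52 in
/-- **THE TOWER: `‖Ū^j(z, κ) − U(L^jz; seg_κ(L^j))‖ ≤ 256(d+1)(d+4)·α₀·(L^j∕L^k)²` FOR `j ≤ k`** — the `j`-fold average (43) of a configuration in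
print's class (52) (values in an averaging-closed subgroup of the unit ball, `C₀α₀ ≤ ⅓`, `2α₀ ≤ c₂′`) against the transporter of the ORIGINAL
configuration along the straight contour of `L^j` fine bonds: induction on (43), `E_{j+1} ≤ L·E_j + 64(d+1)(d+4)L²·pdev(Ū^j)` (§1 at `Ū^j`, §2 with
`N = L^j`), `pdev(Ū^j) < 2α₀(L^j∕L^k)²`, closed by `128L² + 256L ≤ 256L²`.  The deviation is the AREA `α₀(L^jη)²` (`η = L^{−k}`), uniformly in the
number of levels — contrast `B7Eq43AveragedSmallness.norm_avgIter_sub_one_le` (`(8(d+1)L)^j·ε` from bond smallness).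
[cite: Balaban1985Averaging, (42)–(43) pp.23–24, p.25, Prop. 2 (52)–(54) p.26] -/
theorem norm_avgIter_sub_straight_le :
    ∀ j : ℕ, j ≤ k → ∀ (z : B7Prop1Explicit.Site d) (κ : Fin d),
      ‖((avgIter L V j z κ : 𝔸ˣ) : 𝔸) - ((hol V (((L : ℤ) ^ j) • z) (seg κ ((L ^ j : ℕ) : ℤ)) : 𝔸ˣ) : 𝔸)‖ ≤
        256 * (d + 1) * (d + 4) * α₀ * ((L : ℝ) ^ j * ((L : ℝ) ^ k)⁻¹) ^ 2
  | 0, _, z, κ => by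
    have h1 : hol V (((L : ℤ) ^ 0) • z) (seg κ ((L ^ 0 : ℕ) : ℤ)) = V z κ := by
      rw [pow_zero, one_smul, pow_zero, Nat.cast_one, show (1 : ℤ) = (0 : ℤ) + 1 by norm_num, hol_seg_succ, seg_zero, hol_nil, one_mul,
        zero_smul, add_zero]
    rw [avgIter_zero, h1, sub_self, norm_zero]
    positivity
  | j + 1, hj, z, κ => by
    have hL1 : 1 ≤ L := le_trans (by norm_num) hL
    have hLr : (2 : ℝ) ≤ L := by exact_mod_cast hL
    have hjk : j ≤ k := Nat.le_of_succ_le hj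
    have hU1 : ∀ x κ, avgIter L V j x κ ∈ U1 𝔸 := fun x κ => hG.le_U1 (avgIter_mem L hL hG k V hV hα hα3 hα2 h52 j hjk x κ)
    have hV1 : ∀ x κ, V x κ ∈ U1 𝔸 := fun x κ => hG.le_U1 (hV x κ)
    -- the plaquette letter of `Ū^j`
    set a : ℝ := α₀ * ((L : ℝ) ^ j * ((L : ℝ) ^ k)⁻¹) ^ 2 with ha
    have ha0 : 0 ≤ a := by rw [ha]; positivity
    have hpd := pdev_avgIter_lt_two_mul L hL hG k V hV hα hα3 hα2 h52 j hjk
    have hratio : (L : ℝ) ^ j * ((L : ℝ) ^ k)⁻¹ ≤ 1 := by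
      rw [← div_eq_mul_inv, div_le_one (by positivity)]
      exact pow_le_pow_right₀ (by linarith) hjk
    have haα : a ≤ α₀ := by
      rw [ha]
      have : ((L : ℝ) ^ j * ((L : ℝ) ^ k)⁻¹) ^ 2 ≤ 1 := by
        have h0 : 0 ≤ (L : ℝ) ^ j * ((L : ℝ) ^ k)⁻¹ := by positivity
        nlinarith
      nlinarith [hα.le]
    have hsmall : 512 * (d + 1) * (d + 4) * (L : ℝ) ^ 2 * (2 * a) ≤ 1 := by
      have hc2 : 2 * a ≤ c2' d L := by linarith
      unfold c2' at hc2
      rw [le_div_iff₀ (by positivity)] at hc2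
      linarith
    have h44 : ∀ (x : B7Prop1Explicit.Site d) (κ κ' : Fin d), κ ≠ κ' → ‖((hol (avgIter L V j) x (plaqWord κ κ') : 𝔸ˣ) : 𝔸) - 1‖ ≤ 2 * a :=
      fun x κ κ' _ => (le_pdev hU1 x κ κ').trans hpd.le
    -- one step at level `j`
    have hstep := norm_bavg_sub_straight_le_of_pdev L hL1 hU1 (by positivity) hsmall h44 ((L : ℤ) • z) κ
    -- the straight coarse transporter against the straight fine one
    have ih : ∀ i : ℕ, i < L → ‖((avgIter L V j ((L : ℤ) • z + (i : ℤ) • e κ) κ : 𝔸ˣ) : 𝔸) -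
        ((hol V (((L : ℤ) ^ (j + 1)) • z + ((i * L ^ j : ℕ) : ℤ) • e κ) (seg κ ((L ^ j : ℕ) : ℤ)) : 𝔸ˣ) : 𝔸)‖ ≤
          256 * (d + 1) * (d + 4) * α₀ * ((L : ℝ) ^ j * ((L : ℝ) ^ k)⁻¹) ^ 2 := by
      intro i _
      have h := norm_avgIter_sub_straight_le j hjk ((L : ℤ) • z + (i : ℤ) • e κ) κ
      have e1 : ((L : ℤ) ^ j) • ((L : ℤ) • z + (i : ℤ) • e κ) = ((L : ℤ) ^ (j + 1)) • z + ((i * L ^ j : ℕ) : ℤ) • e κ := by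
        rw [smul_add, smul_smul, smul_smul, pow_succ, Nat.cast_mul, Nat.cast_pow, mul_comm (i : ℤ)]
      rwa [e1] at h
    have hseg := norm_hol_seg_sub_hol_seg_le hU1 hV1 (L ^ j) ((L : ℤ) • z) (((L : ℤ) ^ (j + 1)) • z) κ (by positivity) L ih
    rw [avgIter_succ, rescale_apply]
    have hpow : ((L * L ^ j : ℕ) : ℤ) = ((L ^ (j + 1) : ℕ) : ℤ) := by rw [pow_succ, mul_comm]
    rw [hpow] at hseg
    calc _ ≤ ‖((bavg L (avgIter L V j) ((L : ℤ) • z) κ : 𝔸ˣ) : 𝔸) - ((hol (avgIter L V j) ((L : ℤ) • z) (seg κ (L : ℤ)) : 𝔸ˣ) : 𝔸)‖ +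
          ‖((hol (avgIter L V j) ((L : ℤ) • z) (seg κ (L : ℤ)) : 𝔸ˣ) : 𝔸) -
            ((hol V (((L : ℤ) ^ (j + 1)) • z) (seg κ ((L ^ (j + 1) : ℕ) : ℤ)) : 𝔸ˣ) : 𝔸)‖ := norm_sub_le_norm_sub_add_norm_sub _ _ _
      _ ≤ 64 * (d + 1) * (d + 4) * (L : ℝ) ^ 2 * (2 * a) + L * (256 * (d + 1) * (d + 4) * α₀ * ((L : ℝ) ^ j * ((L : ℝ) ^ k)⁻¹) ^ 2) :=
          add_le_add hstep hseg
      _ ≤ 256 * (d + 1) * (d + 4) * α₀ * ((L : ℝ) ^ (j + 1) * ((L : ℝ) ^ k)⁻¹) ^ 2 := by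
          rw [ha]
          set q : ℝ := (d + 1) * (d + 4) * α₀ * ((L : ℝ) ^ j * ((L : ℝ) ^ k)⁻¹) ^ 2 with hqdef
          have hq : 0 ≤ q := by rw [hqdef]; positivity
          have hL2 : 256 * (L : ℝ) ≤ 128 * (L : ℝ) ^ 2 := by nlinarith
          have key := mul_le_mul_of_nonneg_right hL2 hq
          have eL : 64 * (d + 1) * (d + 4) * (L : ℝ) ^ 2 * (2 * (α₀ * ((L : ℝ) ^ j * ((L : ℝ) ^ k)⁻¹) ^ 2)) +
              L * (256 * (d + 1) * (d + 4) * α₀ * ((L : ℝ) ^ j * ((L : ℝ) ^ k)⁻¹) ^ 2) = 128 * (L : ℝ) ^ 2 * q + 256 * (L : ℝ) * q := by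
            rw [hqdef]; ring
          have eR : 256 * (d + 1) * (d + 4) * α₀ * ((L : ℝ) ^ (j + 1) * ((L : ℝ) ^ k)⁻¹) ^ 2 = 256 * (L : ℝ) ^ 2 * q := by
            rw [hqdef, pow_succ]; ring
          rw [eL, eR]
          linarith

end Tower

end Literature.MathematicalPhysics.QuantumFieldTheory.Balaban1983to89.B7Eq47AveragedBondVsStraight

end
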